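import Literature.MathematicalPhysics.QuantumFieldTheory.Balaban1983to89.Beta.DecimatedMomentSummable
import Literature.MathematicalPhysics.QuantumFieldTheory.Balaban1983to89.Beta.KernelRepresentation
import Literature.MathematicalPhysics.QuantumFieldTheory.Balaban1983to89.Beta.MarginalTelescoping

/-!
# Beta/DressedMomentNormalisation — the NORMALISATION LAST MILE: from the entrywise reproduction identities
(L0∞)/(L1∞) of a kernel-represented minimiser and the low moments (T0)/(T1) of the Hessian kernel to the
`N`-power bookkeeping `N⁴ · μ = N^d · M2(T)` of the coarse second moment, and in `d = 4` to
`MarginalTelescoping.IdentityForm`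

HONEST FRAMING (cell `pub-balaban`, β sub-cell, row BETA-an2 gen 5; binding, verbatim): «discharging BetaPertH makes
Balaban's UV stability UNCONDITIONAL — a real constructive-QFT result; it is NOT the continuum limit and NOT the Clay
problem.»  This module is [folklore] bookkeeping of absolutely convergent lattice sums; NOTHING of the manuscripts under
audit ([Balaban1987RG1] = B12 and its companions) is asserted or cited as a fact, and nothing of the wall (M2⁺) of the
cell's records is discharged by it.  Value = kernel bookkeeping leaf, NOT summit progress; NOT continuum, NOT Clay.

CONTEXT (cell records, not literature, not used as facts: HOME/BETA/AN2.md §11 (Y1)–(Y3), (Y17); HOME/BETA-SPEC.md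
§7.23–§7.24 (R11-F)/(R13-2) P1 «normalisation last mile»).  The cell reads the printed second-order coefficient as the
second moment, in COARSE lattice units, of the two-sided dressed kernel `Y, Y′ ↦ Σ_{u,x} W(u − NY)ᵀ · T(u − x) · W(x − NY′)`
(typing (D-a)), where `W(z)_{κl} = w κ l z` is the block-covariant response kernel of the linearised minimiser (the kernel of
`KernelRepresentation.kernelOp N w`: coarse component `l` ↦ fine component `κ`) and `T` the Hessian kernel of the lower
action.  The sibling modules prove the windowed identity for SCALAR (or ring-valued) factors with abstract masses:
`DecimatedMoment.windowed_second_moment_dressed` (finite supports; an2 gen 4) and, with all three factors infinitely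
extended, `DecimatedMomentSummable.decimatedSum_second_moment_hasSum_lattice` (b12 gen 12): windowed second moment
`= σ · m₂ · n₀`.  `KernelRepresentation.lowMoments_of_spec` supplies the ENTRYWISE masses forced by the Euler–Lagrange
structure `AffineReproduction.InfiniteVolumeSpec`: `σ_{κl} = δ_{κl} · N^{−(d+1)}` and affine reproduction constants
`C_{κl}`.  What was left («the last mile», lead's request (R13-2) P1): (i) assembling the entrywise scalar identities into
the MATRIX sandwich `Wᵀ T W` (the left pattern is the TRANSPOSE, the masses are Kronecker deltas, the total mass of a
column is `N^d` coset masses), and (ii) the `N`-power bookkeeping between the spec's normalisation (coarse variable =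
the UN-normalised straight-contour block sum `contourSum N`) and the BOND normalisation of (Y3) (coarse bond variable =
`N^{−d} · contourSum`, i.e. holonomy additivity along the `N` fine bonds of a coarse bond: `W_bond = N^d · W`,
`σ_bond = N^{−1}·1`, `M0(W_bond) = N^{d−1}·1`), in which the coarse second moment in coarse units is `N^{d−4} · M2(T)` —
an IDENTITY in `d = 4` at every fixed block size `N = L^{k−j}`, with NO `N`-uniform estimate consumed.

WHAT THIS FILE PROVES (all [folklore], over `ℝ`):
* §1 residues modulo `N` (`resSite`, `resOf`, `cosetInd_resSite_sub`, `sum_cosetInd_resSite`: every lattice point lies in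
  exactly one residue class) and the TOTAL MASS from the coset masses: `hasSum_total_of_constReproSum`
  (`ConstReproSum N w σ ⟹ HasSum w (N^d · σ)`).
* §2 the matrix dressed kernel ENTRYWISE, `dressedEntry w T y a b = Σ_{c,e} dressedSum (w c a) (T c e) (w e b) y` (the
  `(a,b)` entry of `Σ'_{u,x} W(u)ᵀ T(y+u−x) W(x)`; `dressedEntry_eq_tsum`), and **`secondMoment_dressedEntry_hasSum_lattice`**:
  under entrywise (L0∞) with masses `δ_{κl} N^{−(d+1)}`, entrywise (L1∞), entrywise (T0)/(T1) and absolutely summable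
  second moments (`AbsMoment₂`) of all entries, the `N•ℤ^d`-decimated second moment with weight `(N z)_κ (N z)_λ` of the
  `(a,b)` entry HAS THE SUM `N^{−(d+2)} · Σ'_t t_κ t_λ T a b t` — the scalar identity applied to each `(c,e)` and summed,
  the Kronecker masses collapsing the double sum.
* §3 BOND NORMALISATION: `bondSecondMoment_hasSum` — `Σ_z z_κ z_λ · (N^{2d} · K_{ab}(N z))` has the sum
  `(N^d / N^4) · M2_{κλ}(T)_{ab}`; in `d = 4`: `bondSecondMoment_hasSum_four` / `_tsum_four` — EQUALITY with `M2(T)`.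
* §4 `identityForm_of_kernelFamilies`: for families `N j k ≠ 0`, `w j k`, `T j` (`j < k`) with the §2 hypotheses in
  `d = 4`, and ANY read-out `F` of the second-moment tensor, `μC j k := F (coarse bond tensor of (w j k, T j))` and
  `β0 j := F (M2 tensor of T j)` satisfy `MarginalTelescoping.IdentityForm μC β0` — the shape of the `hid` binder of
  `ComposedRoad.oneLoopDrift_of_composedLegInterfaceOn_identity` (whose `S.β0` must then be identified with this `β0`:
  that is the `hident` binder, NOT this file).
* §5 CONSISTENCY with the finitely supported operator side: `entryHyps_of_spec` — for `S : InfiniteVolumeSpec d N` with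
  `S.H = kernelOp N w` (`w` finitely supported) the (L0∞)/(L1∞) hypotheses of §2 hold (`lowMoments_of_spec` +
  `constReproSum_of_constRepro` / `linReproSum_of_linRepro`).

WHAT THIS FILE DOES NOT DO.  No instance of `InfiniteVolumeSpec` / of a kernel-represented minimiser is constructed (the
cell's residual (O1′): a LOCATED kernel programme — Bloch-fibre nonsingularity + strip analyticity + `latticeKernel` decay,
cell records AN2 §11 (Y18) — not a theorem today); no operator-side bridge for infinitely extended kernels (the summable
analogue of `lowMoments_of_spec`; separate module); (T0)/(T1) for the Hessian kernel are HYPOTHESES here (their finite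
form from symmetries is `DecimatedMoment.low_moments_of_symmetries`; the cell's input (I4′)); no identification of `w`, `T`
with Bałaban's objects and no claim about print's normalisations beyond the cell's typing (D-a)/(Y3), which this file
merely makes explicit and kernel-checked as algebra.  No cited facts are used.

Version v1 (2026-08-19, b2b-balaban-beta-an2-g5).  value = kernel bookkeeping leaf, NOT summit progress.
-/

namespace Literature.MathematicalPhysics.QuantumFieldTheory.Balaban1983to89.Beta.DressedMomentNormalisation

open Finset Filter Topology
open DecimatedMoment DecimatedMomentLimit DecimatedMomentSummable

variable {d N : ℕ}

/-! ## §1 Residues modulo `N` and the total mass of a pattern from its coset masses -/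

/-- The lattice point of a residue vector `r : Fin d → Fin N`. [folklore] -/
def resSite (r : Fin d → Fin N) : Fin d → ℤ := fun i => ((r i : ℕ) : ℤ)

/-- The residue vector of a lattice point (`0 < N`). [folklore] -/
def resOf (hN : 0 < N) (u : Fin d → ℤ) : Fin d → Fin N :=
  fun i => ⟨(u i % (N : ℤ)).toNat, by
    have h0 : (0 : ℤ) ≤ u i % (N : ℤ) := Int.emod_nonneg _ (by exact_mod_cast hN.ne')
    have h1 : u i % (N : ℤ) < (N : ℤ) := Int.emod_lt_of_pos _ (by exact_mod_cast hN)
    exact (Int.toNat_lt h0).2 h1⟩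

/-- The residue of `u` as an integer is `u % N`. [folklore] -/
theorem resSite_resOf (hN : 0 < N) (u : Fin d → ℤ) (i : Fin d) : resSite (resOf hN u) i = u i % (N : ℤ) := by
  simp only [resSite, resOf]
  exact Int.toNat_of_nonneg (Int.emod_nonneg _ (by exact_mod_cast hN.ne'))

/-- `N` divides `r − u` in every coordinate iff `r` is the residue vector of `u`. [folklore] -/
theorem dvd_resSite_sub_iff (hN : 0 < N) (r : Fin d → Fin N) (u : Fin d → ℤ) :
    (∀ i, (N : ℤ) ∣ (resSite r - u) i) ↔ r = resOf hN u := by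
  constructor
  · intro h
    funext i
    have hi := h i
    simp only [Pi.sub_apply, resSite] at hi
    apply Fin.ext
    have hr : ((r i : ℕ) : ℤ) % (N : ℤ) = ((r i : ℕ) : ℤ) :=
      Int.emod_eq_of_lt (by positivity) (by exact_mod_cast (r i).isLt)
    have hmod : u i % (N : ℤ) = ((r i : ℕ) : ℤ) % (N : ℤ) := (Int.modEq_iff_dvd).2 hi
    have : ((r i : ℕ) : ℤ) = (((resOf hN u) i : ℕ) : ℤ) := by
      rw [← resSite, ← resSite, resSite_resOf hN u i, hmod, hr]; rfl
    exact_mod_cast this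
  · rintro rfl i
    simp only [Pi.sub_apply, resSite_resOf hN u i]
    exact (Int.mod_modEq (u i) (N : ℤ)).symm.dvd

/-- The window of the residue class of `r`, evaluated at `u`. [folklore] -/
theorem cosetInd_resSite_sub (hN : 0 < N) (r : Fin d → Fin N) (u : Fin d → ℤ) :
    cosetInd N (resSite r - u) = if r = resOf hN u then 1 else 0 := by
  simp only [cosetInd, dvd_resSite_sub_iff hN r u]

/-- Every lattice point lies in exactly one residue class: `Σ_r cosetInd N (resSite r − u) = 1`. [folklore] -/
theorem sum_cosetInd_resSite (hN : 0 < N) (u : Fin d → ℤ) :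
    ∑ r : Fin d → Fin N, cosetInd N (resSite r - u) = 1 := by
  simp only [cosetInd_resSite_sub hN, Finset.sum_ite_eq', Finset.mem_univ, if_true]

/-- **TOTAL MASS FROM COSET MASSES**: if every residue-class family of `w` has the sum `σ` ((L0∞)/(R0∞),
`ConstReproSum N w σ`), then `w` has the sum `N^d · σ`. [folklore] -/
theorem hasSum_total_of_constReproSum (hN : 0 < N) {w : (Fin d → ℤ) → ℝ} {σ : ℝ} (h : ConstReproSum N w σ) :
    HasSum w ((N : ℝ) ^ d * σ) := by
  have hs := hasSum_sum (s := (Finset.univ : Finset (Fin d → Fin N)))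
    (f := fun r u => cosetInd N (resSite r - u) • w u) (a := fun _ => σ) (fun r _ => h (resSite r))
  have hcard : ∑ _r : Fin d → Fin N, σ = (N : ℝ) ^ d * σ := by
    rw [Finset.sum_const, Finset.card_univ, Fintype.card_pi, Finset.prod_const, Finset.card_univ, Fintype.card_fin,
      Fintype.card_fin, nsmul_eq_mul, Nat.cast_pow]
  rw [hcard] at hs
  refine hs.congr_fun (fun u => ?_)
  rw [← Finset.sum_smul, sum_cosetInd_resSite hN u, one_zsmul]

/-! ## §2 The matrix dressed kernel, entrywise, and its decimated second moment -/

/-- ENTRY KERNELS: `w κ l : ℤ^d → ℝ`, the `(κ, l)` entry of a matrix-valued lattice kernel (for the response kernel of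
`KernelRepresentation.kernelOp N w`: fine component `κ`, coarse component `l`). [folklore] -/
abbrev EKer (d : ℕ) : Type := Fin d → Fin d → (Fin d → ℤ) → ℝ

/-- The `(a, b)` ENTRY OF THE TWO-SIDED DRESSED KERNEL `Σ'_{u,x} W(u)ᵀ · T(y + u − x) · W(x)` as a function of the output
point `y`: `Σ_{c,e} dressedSum (w c a) (T c e) (w e b) y` (left pattern = the transpose `(Wᵀ)_{ac} = w c a`). [folklore] -/
noncomputable def dressedEntry (w T : EKer d) (y : Fin d → ℤ) (a b : Fin d) : ℝ :=
  ∑ c, ∑ e, dressedSum (w c a) (T c e) (w e b) y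

/-- `dressedEntry` IS the entry of the matrix sandwich summed over `(u, x) ∈ ℤ^d × ℤ^d` (absolutely summable entries).
[folklore] -/
theorem dressedEntry_eq_tsum (w T : EKer d) (hw : ∀ κ l, AbsMoment₂ (w κ l)) (hT : ∀ c e, AbsMoment₂ (T c e))
    (y : Fin d → ℤ) (a b : Fin d) :
    dressedEntry w T y a b
      = ∑' p : (Fin d → ℤ) × (Fin d → ℤ), ∑ c, ∑ e, w c a p.1 * T c e (y + p.1 - p.2) * w e b p.2 := by
  unfold dressedEntry dressedSum
  rw [Summable.tsum_finsetSum (fun c _ => summable_sum (fun e _ => summable_dressed_fibre (hw c a) (hT c e) (hw e b) y))]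
  refine Finset.sum_congr rfl (fun c _ => ?_)
  rw [Summable.tsum_finsetSum (fun e _ => summable_dressed_fibre (hw c a) (hT c e) (hw e b) y)]

/-- **THE DECIMATED SECOND MOMENT OF AN ENTRY OF THE DRESSED KERNEL** (spec normalisation).  Entrywise (L0∞) with the
Kronecker masses `δ_{κl} · N^{−(d+1)}` and entrywise (L1∞) for `w`, entrywise (T0)/(T1) for `T`, absolutely summable second
moments; then `z ↦ (N² z_κ z_λ) • K_{ab}(N z)` has the sum `N^{−(d+2)} · Σ'_t t_κ t_λ T a b t`. [folklore] -/
theorem secondMoment_dressedEntry_hasSum_lattice (hN : 0 < N) (w T : EKer d)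
    (hw0 : ∀ κ l, ConstReproSum N (w κ l) (if κ = l then (((N : ℝ) ^ (d + 1))⁻¹) else 0))
    (hw1 : ∀ κ l, ∃ C : Fin d → ℝ, LinReproSum N (w κ l) C)
    (hwA : ∀ κ l, AbsMoment₂ (w κ l)) (hTA : ∀ c e, AbsMoment₂ (T c e))
    (hT0 : ∀ c e, HasSum (T c e) 0) (hT1 : ∀ c e (μ : Fin d), HasSum (fun t => t μ • T c e t) 0)
    (κ lam a b : Fin d) :
    HasSum (fun z : Fin d → ℤ => ((N : ℤ) ^ 2 * (z κ * z lam)) • dressedEntry w T ((N : ℤ) • z) a b)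
      ((((N : ℝ) ^ (d + 2))⁻¹) * ∑' t, (t κ * t lam) • T a b t) := by
  have hNne : N ≠ 0 := hN.ne'
  -- the scalar identity for each pair (c, e)
  have hce : ∀ c e : Fin d,
      HasSum (fun z : Fin d → ℤ => ((N : ℤ) ^ 2 * (z κ * z lam)) • dressedSum (w c a) (T c e) (w e b) ((N : ℤ) • z))
        ((if c = a then (((N : ℝ) ^ (d + 1))⁻¹) else 0) * (∑' t, (t κ * t lam) • T c e t)
          * ((N : ℝ) ^ d * (if e = b then (((N : ℝ) ^ (d + 1))⁻¹) else 0))) := by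
    intro c e
    obtain ⟨C, hC⟩ := hw1 c a
    exact decimatedSum_second_moment_hasSum_lattice hNne (w c a) (T c e) (w e b) (hw0 c a) hC (hw0 e b) κ lam
      (hT0 c e) (hT1 c e κ) (hT1 c e lam)
      (summable_smul_of_absMoment₂ (hTA c e) (IsMoment₂.coord2 κ lam)).hasSum
      (hasSum_total_of_constReproSum hN (hw0 e b))
      (monoSummable_of_absMoment₂ (abs_cosetInd_le_one N) (hwA c a) (hTA c e) (hwA e b))
      (fun y => summable_dressed_fibre (hwA c a) (hTA c e) (hwA e b) y)
  have hs := hasSum_sum (s := (Finset.univ : Finset (Fin d)))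
    (fun c _ => hasSum_sum (s := (Finset.univ : Finset (Fin d))) (fun e _ => hce c e))
  -- collapse the Kronecker masses
  have hval : ∑ c, ∑ e, (if c = a then (((N : ℝ) ^ (d + 1))⁻¹) else 0) * (∑' t, (t κ * t lam) • T c e t)
        * ((N : ℝ) ^ d * (if e = b then (((N : ℝ) ^ (d + 1))⁻¹) else 0))
      = (((N : ℝ) ^ (d + 2))⁻¹) * ∑' t, (t κ * t lam) • T a b t := by
    simp only [mul_ite, mul_zero, ite_mul, zero_mul, Finset.sum_ite_eq', Finset.mem_univ, if_true]
    have hN' : (N : ℝ) ≠ 0 := by exact_mod_cast hNne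
    field_simp
    ring
  rw [hval] at hs
  refine hs.congr_fun (fun z => ?_)
  simp only [dressedEntry, Finset.smul_sum]

/-! ## §3 Bond normalisation: `N⁴ · μ = N^d · M2(T)`; equality in `d = 4` -/

/-- **BOND NORMALISATION.**  With the coarse bond variable `N^{−d} · contourSum` (so `W_bond = N^d · W` on both sides of
the sandwich, `K_bond = N^{2d} · K`) the coarse second moment in COARSE units, `Σ_z z_κ z_λ · K_bond,ab(N z)`, has the
sum `(N^d / N^4) · Σ'_t t_κ t_λ T a b t`. [folklore] -/
theorem bondSecondMoment_hasSum (hN : 0 < N) (w T : EKer d)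
    (hw0 : ∀ κ l, ConstReproSum N (w κ l) (if κ = l then (((N : ℝ) ^ (d + 1))⁻¹) else 0))
    (hw1 : ∀ κ l, ∃ C : Fin d → ℝ, LinReproSum N (w κ l) C)
    (hwA : ∀ κ l, AbsMoment₂ (w κ l)) (hTA : ∀ c e, AbsMoment₂ (T c e))
    (hT0 : ∀ c e, HasSum (T c e) 0) (hT1 : ∀ c e (μ : Fin d), HasSum (fun t => t μ • T c e t) 0)
    (κ lam a b : Fin d) :
    HasSum (fun z : Fin d → ℤ => ((z κ * z lam : ℤ) : ℝ) * ((N : ℝ) ^ (2 * d) * dressedEntry w T ((N : ℤ) • z) a b))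
      ((N : ℝ) ^ d / (N : ℝ) ^ 4 * ∑' t, (t κ * t lam) • T a b t) := by
  have hN' : (N : ℝ) ≠ 0 := by exact_mod_cast hN.ne'
  have h := (secondMoment_dressedEntry_hasSum_lattice hN w T hw0 hw1 hwA hTA hT0 hT1 κ lam a b).mul_left
    ((N : ℝ) ^ (2 * d) / (N : ℝ) ^ 2)
  have hval : (N : ℝ) ^ (2 * d) / (N : ℝ) ^ 2 * ((((N : ℝ) ^ (d + 2))⁻¹) * ∑' t, (t κ * t lam) • T a b t)
      = (N : ℝ) ^ d / (N : ℝ) ^ 4 * ∑' t, (t κ * t lam) • T a b t := by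
    field_simp
    ring
  rw [hval] at h
  refine h.congr_fun (fun z => ?_)
  simp only [zsmul_eq_mul, Int.cast_mul, Int.cast_pow, Int.cast_natCast]
  field_simp

/-- **`d = 4`: THE COARSE BOND SECOND MOMENT EQUALS `M2(T)`** — at every fixed block size `N ≥ 1`, no estimate.
[folklore] -/
theorem bondSecondMoment_hasSum_four (hN : 0 < N) (w T : EKer 4)
    (hw0 : ∀ κ l, ConstReproSum N (w κ l) (if κ = l then (((N : ℝ) ^ (4 + 1))⁻¹) else 0))
    (hw1 : ∀ κ l, ∃ C : Fin 4 → ℝ, LinReproSum N (w κ l) C)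
    (hwA : ∀ κ l, AbsMoment₂ (w κ l)) (hTA : ∀ c e, AbsMoment₂ (T c e))
    (hT0 : ∀ c e, HasSum (T c e) 0) (hT1 : ∀ c e (μ : Fin 4), HasSum (fun t => t μ • T c e t) 0)
    (κ lam a b : Fin 4) :
    HasSum (fun z : Fin 4 → ℤ => ((z κ * z lam : ℤ) : ℝ) * ((N : ℝ) ^ 8 * dressedEntry w T ((N : ℤ) • z) a b))
      (∑' t, (t κ * t lam) • T a b t) := by
  have hN' : (N : ℝ) ≠ 0 := by exact_mod_cast hN.ne'
  have h := bondSecondMoment_hasSum hN w T hw0 hw1 hwA hTA hT0 hT1 κ lam a b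
  rw [show (2 * 4 : ℕ) = 8 from rfl, div_self (pow_ne_zero 4 hN'), one_mul] at h
  exact h

/-- `tsum` form of the `d = 4` identity. [folklore] -/
theorem bondSecondMoment_tsum_four (hN : 0 < N) (w T : EKer 4)
    (hw0 : ∀ κ l, ConstReproSum N (w κ l) (if κ = l then (((N : ℝ) ^ (4 + 1))⁻¹) else 0))
    (hw1 : ∀ κ l, ∃ C : Fin 4 → ℝ, LinReproSum N (w κ l) C)
    (hwA : ∀ κ l, AbsMoment₂ (w κ l)) (hTA : ∀ c e, AbsMoment₂ (T c e))
    (hT0 : ∀ c e, HasSum (T c e) 0) (hT1 : ∀ c e (μ : Fin 4), HasSum (fun t => t μ • T c e t) 0)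
    (κ lam a b : Fin 4) :
    ∑' z : Fin 4 → ℤ, ((z κ * z lam : ℤ) : ℝ) * ((N : ℝ) ^ 8 * dressedEntry w T ((N : ℤ) • z) a b)
      = ∑' t, (t κ * t lam) • T a b t :=
  (bondSecondMoment_hasSum_four hN w T hw0 hw1 hwA hTA hT0 hT1 κ lam a b).tsum_eq

/-! ## §4 `IdentityForm` for families of kernels in `d = 4` -/

/-- The HYPOTHESES of §2 on a pair (response kernel `w`, Hessian kernel `T`) at block size `N`, packaged. [folklore] -/
structure EntryHyps (N : ℕ) (w T : EKer 4) : Prop where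
  pos : 0 < N
  const : ∀ κ l, ConstReproSum N (w κ l) (if κ = l then (((N : ℝ) ^ (4 + 1))⁻¹) else 0)
  lin : ∀ κ l, ∃ C : Fin 4 → ℝ, LinReproSum N (w κ l) C
  absW : ∀ κ l, AbsMoment₂ (w κ l)
  absT : ∀ c e, AbsMoment₂ (T c e)
  T0 : ∀ c e, HasSum (T c e) 0
  T1 : ∀ c e (μ : Fin 4), HasSum (fun t => t μ • T c e t) 0

/-- The coarse BOND second-moment tensor of the pair `(w, T)` at block size `N` (coarse units). [folklore] -/
noncomputable def coarseTensor (N : ℕ) (w T : EKer 4) : Fin 4 → Fin 4 → Fin 4 → Fin 4 → ℝ :=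
  fun κ lam a b => ∑' z : Fin 4 → ℤ, ((z κ * z lam : ℤ) : ℝ) * ((N : ℝ) ^ 8 * dressedEntry w T ((N : ℤ) • z) a b)

/-- The second-moment tensor `M2_{κλ}(T)_{ab} = Σ'_t t_κ t_λ T a b t` of a matrix kernel. [folklore] -/
noncomputable def m2Tensor (T : EKer 4) : Fin 4 → Fin 4 → Fin 4 → Fin 4 → ℝ :=
  fun κ lam a b => ∑' t : Fin 4 → ℤ, (t κ * t lam) • T a b t

/-- In `d = 4` the coarse bond tensor IS the second-moment tensor of `T`. [folklore] -/
theorem coarseTensor_eq_m2Tensor {w T : EKer 4} (h : EntryHyps N w T) : coarseTensor N w T = m2Tensor T := by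
  funext κ lam a b
  exact bondSecondMoment_tsum_four h.pos w T h.const h.lin h.absW h.absT h.T0 h.T1 κ lam a b

/-- **`IdentityForm` FROM KERNEL FAMILIES.**  Block sizes `Nf j k`, composed response kernels `w j k` (scale-`k` coarse data
↦ scale-`j` field) and Hessian kernels `T j` with the entrywise hypotheses for every `j < k`; ANY read-out `F` of the
second-moment tensor (print's choice of components is a special case).  Then `μC j k := F (coarseTensor …)` and
`β0 j := F (m2Tensor (T j))` satisfy `MarginalTelescoping.IdentityForm μC β0` — the `hid` binder shape of
`ComposedRoad.oneLoopDrift_of_composedLegInterfaceOn_identity`. [folklore] -/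
theorem identityForm_of_kernelFamilies (Nf : ℕ → ℕ → ℕ) (w : ℕ → ℕ → EKer 4) (T : ℕ → EKer 4)
    (h : ∀ j k, j < k → EntryHyps (Nf j k) (w j k) (T j)) (F : (Fin 4 → Fin 4 → Fin 4 → Fin 4 → ℝ) → ℝ) :
    MarginalTelescoping.IdentityForm (fun j k => F (coarseTensor (Nf j k) (w j k) (T j))) (fun j => F (m2Tensor (T j))) := by
  intro j k hjk
  show F (coarseTensor (Nf j k) (w j k) (T j)) = F (m2Tensor (T j))
  rw [coarseTensor_eq_m2Tensor (h j k hjk)]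

/-- … hence for any target sequence `β0` IDENTIFIED with the read-out of the `M2` tensors (the `hident` side, a hypothesis
here) the composed coefficients satisfy `IdentityForm μC β0`. [folklore] -/
theorem identityForm_of_kernelFamilies' (Nf : ℕ → ℕ → ℕ) (w : ℕ → ℕ → EKer 4) (T : ℕ → EKer 4)
    (h : ∀ j k, j < k → EntryHyps (Nf j k) (w j k) (T j)) (F : (Fin 4 → Fin 4 → Fin 4 → Fin 4 → ℝ) → ℝ)
    {β0 : ℕ → ℝ} (hβ : ∀ j, β0 j = F (m2Tensor (T j))) :
    MarginalTelescoping.IdentityForm (fun j k => F (coarseTensor (Nf j k) (w j k) (T j))) β0 := by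
  intro j k hjk
  rw [hβ j]
  exact identityForm_of_kernelFamilies Nf w T h F j k hjk

/-! ## §5 Consistency with the finitely supported operator side (`KernelRepresentation.lowMoments_of_spec`) -/

/-- For a kernel-represented spec with FINITELY SUPPORTED response kernel the entrywise (L0∞)/(L1∞) hypotheses of §2
hold (with `d`, `N` general). [folklore] -/
theorem entryHyps_of_spec [NeZero N] (S : AffineReproduction.InfiniteVolumeSpec d N)
    (w : Fin d → Fin d → MomentFactorisation.LatFun d ℝ) (hrep : S.H = KernelRepresentation.kernelOp N w) (κ l : Fin d) :
    ConstReproSum N ⇑(w κ l) (if κ = l then (((N : ℝ) ^ (d + 1))⁻¹) else 0)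
      ∧ ∃ C : Fin d → ℝ, LinReproSum N ⇑(w κ l) C := by
  obtain ⟨h0, C, h1⟩ := KernelRepresentation.lowMoments_of_spec S w hrep κ l
  exact ⟨constReproSum_of_constRepro N (w κ l) h0, C, linReproSum_of_linRepro N (w κ l) h1⟩

end Literature.MathematicalPhysics.QuantumFieldTheory.Balaban1983to89.Beta.DressedMomentNormalisation
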